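import Literature.NumberTheory.EllipticCurves.HeegnerPointsKolyvaginTorsionProofs
import Summits.BirchSwinnertonDyer.BirchSwinnertonDyer.Theses.KolyvaginRankRigidityAtTwo
import HarnessLib

/-!
# Route `KolyvaginRankRigidityAtTwo`, support `NoTwoTorsionOverK` (stmt-BirchSwinnertonDyer-23952):
# `E(K)[2] = 0` over an imaginary quadratic `K` when `ρ̄_{E,2}` is onto `GL₂(𝔽₂) ≅ S₃`

The tree proves `E(K)[p] = 0` for `[K : ℚ] = 2`, `ρ̄_{E,p}` onto and `p` ODD
(`Literature.NumberTheory.EllipticCurves.torsionBy_eq_bot_of_hasSurjectiveModNGaloisRep`, Gross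
1991 §2): a `K`-rational `p`-torsion point pulls back to `0 ≠ Q ∈ E[p]` fixed by `Γ_K`, hence by
every square of `Γ_ℚ` (`exists_resGal_eq_mul_self`), hence by `g²` for every `g ∈ Aut(E[p])`,
and for `p` odd a transvection has `g² Q ≠ Q`. At `p = 2` transvections are involutions, but the
conclusion survives: `Aut(E[2]) ≅ GL₂(𝔽₂) ≅ S₃` contains an element `g` of order `3` (a
`3`-cycle on the three non-zero points), and `g² = g⁻¹` fixes no non-zero vector. This file proves
that replacement lemma (`exists_addAut_apply_apply_ne_two`) and reruns the tree's argument at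
`p = 2`, giving the route's support item `NoTwoTorsionOverK` (only `m = 1` of the hypothesis
«`ρ̄_{E,2^m}` onto for all `m`» is used). Equivalently: the 2-division cubic is irreducible with
group `S₃`, so a `2`-torsion point generates a cubic field, which does not lie in the quadratic
field `K` (Serre 1972 §5.3; Silverman AEC III.§7).

HONEST FRAMING: an elementary support item; BSD is not proved by this file.
-/

set_option autoImplicit false
-- the Theorems namespace of this sub repeats the summit name by design (D-0017 nested layout)
set_option linter.dupNamespace false

noncomputable section

open scoped Classical

universe u

open Field (absoluteGaloisGroup)
open Field.absoluteGaloisGroup (toAlgEquiv)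
open WeierstrassCurve Literature.NumberTheory.EllipticCurves

namespace Summit.BirchSwinnertonDyer.BirchSwinnertonDyer.Theorems.KolyvaginRankRigidity

/-! ## Group theory in `E[2] ≅ (ℤ/2ℤ)²` -/

/-- In an elementary abelian `2`-group `M` of order `4`, no non-zero element is fixed by the squares
of all automorphisms: for `Q ≠ 0` there is `g ∈ Aut(M)` with `g (g Q) ≠ Q`. Take `w ∉ {0, Q}`;
the linear map `f` with `f Q = Q + w`, `f (Q + w) = w`, `f w = Q` is an automorphism of order `3`
(the `3`-cycle of `GL₂(𝔽₂) ≅ S₃`) and `f (f Q) = w ≠ Q`. [folklore] -/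
theorem exists_addAut_apply_apply_ne_two {M : Type*} [AddCommGroup M] [Module (ZMod 2) M]
    [Finite M] (hcard : Nat.card M = 2 ^ 2) {Q : M} (hQ : Q ≠ 0) :
    ∃ g : AddAut M, g (g Q) ≠ Q := by
  obtain ⟨lam, hlam⟩ := Module.Projective.exists_dual_eq_one (ZMod 2) hQ
  haveI : Fintype M := Fintype.ofFinite M
  have hcardM : Fintype.card M = 4 := by rw [Fintype.card_eq_nat_card, hcard]; norm_num
  have hlt : Fintype.card (ZMod 2) < Fintype.card M := by rw [ZMod.card, hcardM]; norm_num
  obtain ⟨x, y, hxy, hfxy⟩ := Fintype.exists_ne_map_eq_of_card_lt lam hlt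
  set w := x - y with hw
  have hw0 : w ≠ 0 := sub_ne_zero.mpr hxy
  have hlw : lam w = 0 := by rw [hw, map_sub, hfxy, sub_self]
  obtain ⟨mu₀, hmu₀⟩ := Module.Projective.exists_dual_eq_one (ZMod 2) hw0
  let mu : Module.Dual (ZMod 2) M := mu₀ - (mu₀ Q) • lam
  have hmuQ : mu Q = 0 := by
    simp only [mu, LinearMap.sub_apply, LinearMap.smul_apply, hlam, smul_eq_mul, mul_one, sub_self]
  have hmuw : mu w = 1 := by
    simp only [mu, LinearMap.sub_apply, LinearMap.smul_apply, hmu₀, hlw, smul_eq_mul, mul_zero,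
      sub_zero]
  -- characteristic `2`
  have h20 : (2 : ZMod 2) = 0 := by decide
  have h2 : ∀ m : M, m + m = 0 := fun m ↦ by rw [← two_smul (ZMod 2) m, h20, zero_smul]
  -- `(lam, mu) : M → 𝔽₂²` is a bijection (onto, equal cardinalities), in particular injective
  let φ : M →ₗ[ZMod 2] (ZMod 2 × ZMod 2) := LinearMap.prod lam mu
  have hφsurj : Function.Surjective φ := by
    rintro ⟨a, b⟩
    refine ⟨a • Q + b • w, ?_⟩
    change (lam (a • Q + b • w), mu (a • Q + b • w)) = (a, b)
    rw [map_add, map_smul, map_smul, hlam, hlw, map_add, map_smul, map_smul, hmuQ, hmuw,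
      smul_eq_mul, smul_eq_mul, smul_eq_mul, smul_eq_mul, mul_one, mul_zero, add_zero, mul_zero,
      mul_one, zero_add]
  have hφbij : Function.Bijective φ := by
    rw [Fintype.bijective_iff_surjective_and_card]
    refine ⟨hφsurj, ?_⟩
    rw [hcardM, Fintype.card_prod, ZMod.card]
  have hsep : ∀ m : M, lam m = 0 → mu m = 0 → m = 0 := by
    intro m h1 h2
    apply hφbij.1
    rw [map_zero]
    change (lam m, mu m) = 0
    rw [h1, h2, Prod.mk_zero_zero]
  -- the order-`3` automorphism
  let f : M →ₗ[ZMod 2] M := lam.smulRight (Q + w) + mu.smulRight Q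
  have hf : ∀ m, f m = lam m • (Q + w) + mu m • Q := fun m ↦ rfl
  have hfinj : Function.Injective f := by
    intro a b hab
    rw [← sub_eq_zero] at hab ⊢
    rw [← map_sub] at hab
    set m := a - b
    have hl : lam (f m) = lam m + mu m := by
      rw [hf, map_add, map_smul, map_smul, map_add, hlam, hlw, add_zero, smul_eq_mul, smul_eq_mul,
        mul_one, mul_one]
    have hm : mu (f m) = lam m := by
      rw [hf, map_add, map_smul, map_smul, map_add, hmuQ, hmuw, zero_add, smul_eq_mul, smul_eq_mul,
        mul_one, mul_zero, add_zero]
    rw [hab, map_zero] at hl hm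
    have h1 : lam m = 0 := hm.symm
    have h2' : mu m = 0 := by rw [h1, zero_add] at hl; exact hl.symm
    exact hsep m h1 h2'
  have hfbij : Function.Bijective f := Finite.injective_iff_bijective.mp hfinj
  let g : AddAut M := AddEquiv.ofBijective f.toAddMonoidHom hfbij
  have hg : ∀ m, g m = f m := fun _ ↦ rfl
  have hfQ : f Q = Q + w := by
    rw [hf, hlam, hmuQ, one_smul, zero_smul, add_zero]
  have hfQw : f (Q + w) = w := by
    rw [hf, map_add, map_add, hlam, hlw, hmuQ, hmuw, add_zero, zero_add, one_smul, one_smul,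
      add_assoc, add_comm w Q, ← add_assoc, h2 Q, zero_add]
  refine ⟨g, fun h ↦ ?_⟩
  rw [hg, hg Q, hfQ, hfQw] at h
  rw [h, hlam] at hlw
  exact one_ne_zero hlw

/-! ## `E(K)[2] = 0` -/

/-- **`E(K)[2] = 0` for a quadratic number field `K` (in `Type`) when `ρ̄_{E,2}` is onto** — the
`p = 2` case of the tree's `torsionBy_eq_bot_of_hasSurjectiveModNGaloisRep_type` (Gross 1991 §2,
`p` odd), by the same argument with `exists_addAut_apply_apply_ne_two` in place of the transvection:
a `K`-rational `2`-torsion point pulls back to `0 ≠ Q ∈ E[2]` fixed by `Γ_K`, hence by all squares of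
`Γ_ℚ` (`exists_resGal_eq_mul_self`), hence by `g²` for every `g ∈ Aut(E[2])` (`ρ̄` onto),
contradicting the order-`3` element (`#E[2] = 4`, `card_torsionPoints_eq_sq_holds`). [folklore] -/
theorem torsionBy_two_eq_bot_of_hasSurjectiveModNGaloisRep_type (K : Type) [Field K] [NumberField K]
    (W : WeierstrassCurve ℚ) [W.IsElliptic] (hK : Module.finrank ℚ K = 2)
    (hρ : W.HasSurjectiveModNGaloisRep 2) :
    AddSubgroup.torsionBy (W.baseChange K).toAffine.Point (2 : ℤ) = ⊥ := by
  rw [eq_bot_iff]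
  intro P hP
  rw [AddSubgroup.mem_bot]
  by_contra hP0
  have hPp : (2 : ℕ) • P = 0 := AddSubgroup.torsionBy.nsmul_iff.mp hP
  -- the point over `K̄` and its preimage `Q` over `ℚ̄`
  let f : K →ₐ[ℚ] AlgebraicClosure K := (algebraMap K (AlgebraicClosure K)).toRatAlgHom
  let φ : (W.baseChange K).toAffine.Point →+ localPoints W K :=
    WeierstrassCurve.Affine.Point.map f
  have hφ : Function.Injective φ := WeierstrassCurve.Affine.Point.map_injective _
  obtain ⟨Q, hQ⟩ := (pointsMapOfEmb_bijective K W (closureEmb (K := ℚ) K)).2 (φ P)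
  have hQ' : pointsMap W K Q = φ P := hQ
  have hinj : Function.Injective (pointsMap W K) :=
    (pointsMapOfEmb_bijective K W (closureEmb (K := ℚ) K)).1
  have hQ0 : Q ≠ 0 := by
    rintro rfl
    apply hP0
    apply hφ
    rw [map_zero, ← hQ', map_zero]
  have hQp : (2 : ℕ) • Q = 0 := by
    apply hinj
    rw [map_nsmul, map_zero, hQ', ← map_nsmul, hPp, map_zero]
  -- `Q` is fixed by `Γ_K`
  have hfixK : ∀ τ : absoluteGaloisGroup K, resGal (K := ℚ) K τ • Q = Q := by
    intro τ
    apply hinj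
    rw [pointsMap_smul, hQ']
    change WeierstrassCurve.Affine.Point.map
        ((AlgEquiv.restrictScalars ℚ (toAlgEquiv K τ) :
            AlgebraicClosure K ≃ₐ[ℚ] AlgebraicClosure K) :
          AlgebraicClosure K →ₐ[ℚ] AlgebraicClosure K)
        (WeierstrassCurve.Affine.Point.map f P) =
      WeierstrassCurve.Affine.Point.map f P
    have hgf : ((AlgEquiv.restrictScalars ℚ (toAlgEquiv K τ) :
            AlgebraicClosure K ≃ₐ[ℚ] AlgebraicClosure K) :
          AlgebraicClosure K →ₐ[ℚ] AlgebraicClosure K).comp f = f := by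
      ext x
      exact (toAlgEquiv K τ).commutes x
    rw [WeierstrassCurve.Affine.Point.map_map, hgf]
  -- hence by all squares of `Γ_ℚ`
  have hsq : ∀ σ : absoluteGaloisGroup ℚ, (σ * σ) • Q = Q := by
    intro σ
    obtain ⟨τ, hτ⟩ := exists_resGal_eq_mul_self K hK σ
    rw [← hτ]
    exact hfixK τ
  -- the group theory in `E[2]`
  let M := ↥(WeierstrassCurve.geomTorsion W (2 : ℤ))
  letI : Module (ZMod 2) M := AddSubgroup.torsionBy.zmodModule
  have hcardM : Nat.card M = 2 ^ 2 := by
    have := WeierstrassCurve.card_torsionPoints_eq_sq_holds W (AlgebraicClosure ℚ) (n := 2)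
      (by norm_num)
    exact this
  haveI : Finite M := Nat.finite_of_card_ne_zero (by rw [hcardM]; norm_num)
  let Qm : M := ⟨Q, AddSubgroup.torsionBy.nsmul_iff.mpr hQp⟩
  have hQm0 : Qm ≠ 0 := fun h ↦ hQ0 (congrArg Subtype.val h)
  obtain ⟨g, hg⟩ := exists_addAut_apply_apply_ne_two hcardM hQm0
  obtain ⟨σ, hσ⟩ := (show Function.Surjective _ from hρ) (Multiplicative.ofAdd g)
  apply hg
  have hgσ : ∀ R : M, g R = σ • R := fun R ↦ by
    have := WeierstrassCurve.galoisRepTorsion_apply (W := W) (2 : ℤ) σ R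
    rw [hσ, toAdd_ofAdd] at this
    exact this
  rw [hgσ, hgσ, ← mul_smul]
  apply Subtype.ext
  exact hsq σ

/-- **`E(K)[2] = 0` for a quadratic number field `K` (any universe) when `ρ̄_{E,2}` is onto**:
`torsionBy_two_eq_bot_of_hasSurjectiveModNGaloisRep_type` for a `ℚ`-isomorphic model of `K` in
`Type` (`exists_algEquiv_numberField_type`), transported by `torsionBy_eq_bot_of_algEquiv`.
[folklore] -/
theorem torsionBy_two_eq_bot_of_hasSurjectiveModNGaloisRep (W : WeierstrassCurve ℚ) [W.IsElliptic]
    (K : Type u) [Field K] [NumberField K] (hK : Module.finrank ℚ K = 2)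
    (hρ : W.HasSurjectiveModNGaloisRep 2) :
    AddSubgroup.torsionBy (W.baseChange K).toAffine.Point (2 : ℤ) = ⊥ := by
  obtain ⟨K₀, _, _, ⟨e⟩⟩ := exists_algEquiv_numberField_type K
  have hK₀ : Module.finrank ℚ K₀ = 2 := by rw [← hK]; exact e.toLinearEquiv.finrank_eq
  exact torsionBy_eq_bot_of_algEquiv W e (p := 2)
    (torsionBy_two_eq_bot_of_hasSurjectiveModNGaloisRep_type K₀ W hK₀ hρ)

/-! ## The route item -/

/-- **Support item `NoTwoTorsionOverK` of route `KolyvaginRankRigidityAtTwo`**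
(stmt-BirchSwinnertonDyer-23952): if `ρ̄_{E,2^m}` is onto for all `m` (only `m = 1` is used:
`Gal(ℚ(E[2])/ℚ) ≅ GL₂(𝔽₂) ≅ S₃`) and `K` is imaginary quadratic, then `E(K)[2] = 0`. -/
theorem noTwoTorsionOverK_proof :
    Summit.BirchSwinnertonDyer.BirchSwinnertonDyer.Theses.KolyvaginRankRigidityAtTwo.NoTwoTorsionOverK := by
  unfold Summit.BirchSwinnertonDyer.BirchSwinnertonDyer.Theses.KolyvaginRankRigidityAtTwo.NoTwoTorsionOverK
  intro W _ hsur K _ _ hK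
  have h1 : W.HasSurjectiveModNGaloisRep ((2 ^ 1 : ℕ) : ℤ) := hsur 1
  rw [pow_one] at h1
  exact torsionBy_two_eq_bot_of_hasSurjectiveModNGaloisRep W K hK.1 h1

end Summit.BirchSwinnertonDyer.BirchSwinnertonDyer.Theorems.KolyvaginRankRigidity
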